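import Summits.KontsevichZagierPeriods.KontsevichZagierPeriods.Theorems.LinRedNormalFormDihedralNormalFormStubTorusDescentAux2
import Literature.NumberTheory.Transcendental.KZSemiCanonicalReductionProofs
import Literature.NumberTheory.Transcendental.KZProductIdeal

/-!
# `DihedralNormalForm`, line `torus-descent-sum-shadow`, stub `stub_torusDescent` — the band and the base (Aux 3)

Support file for the stub `stub_torusDescent` of the crux `DihedralNormalForm`
(stmt-KontsevichZagierPeriods-3912, route `LinRedNormalForm`). The analysis of ONE torus descent
(structure `Descent`: an atom `s = [□ᵏ⁺¹, q · atomFun a e]`, a simple descent direction `lam`,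
an entry face `p`):

* `reix p` — the relabelling `p ↦ last`, `p.succAbove j ↦ castSucc j`, under which the entry piece
  `piece lam p = D_p` becomes `wedge (lam ∘ p.succAbove)` (`setOf_comp_reix_mem_piece`);
* the transformed integrand `bandFun = q · g₀(insertNth p 1 y) · s^{−E−1}` on the straightened
  band, its monomial primitive `primFun = −(q/E) · g₀ · s^{−E}` (`hasDerivAt_primFun`), the
  closed band `{y ∈ □ᵏ, M_p(y) ≤ s ≤ 1}` and its null difference with the open band `wedge (−μ)`;
* the fibre dichotomy `M_p(y) > 0 ∨ E < 0` and the fibrewise Newton–Leibniz inequality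
  `‖base y‖ₑ ≤ ∫⁻_{[M_p(y),1]} ‖bandFun (y,s)‖ₑ ds` (`enorm_baseFun_le`), the analytic input of
  the absolute convergence of the base.

References: M. Kontsevich, D. Zagier, *Periods* (2001), §1.2 (rules (1)–(3)).
-/

noncomputable section

open MeasureTheory Set MvPolynomial
open scoped ENNReal
open Literature.ModelTheory.ExponentialFields (IsSemialgebraic)

namespace Summit.KontsevichZagierPeriods.DihedralNormalForm.TorusDescent

open Literature.NumberTheory.Transcendental
open Literature.ModelTheory.ExponentialFields

variable {k : ℕ}

/-! ### The reindexing `p ↦ last` -/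

/-- The coordinate relabelling sending `p` to the last place and `p.succAbove j` to `castSucc j`. -/
def reix (p : Fin (k + 1)) : Fin (k + 1) ≃ Fin (k + 1) :=
  (finSuccEquiv' p).trans (finSuccEquiv' (Fin.last k)).symm

/-- `reix p p = last`. [folklore] -/
@[simp] theorem reix_self (p : Fin (k + 1)) : reix p p = Fin.last k := by
  simp [reix, finSuccEquiv'_symm_none]

/-- `reix p (p.succAbove j) = castSucc j`. [folklore] -/
@[simp] theorem reix_succAbove (p : Fin (k + 1)) (j : Fin k) :
    reix p (p.succAbove j) = Fin.castSucc j := by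
  simp [reix, finSuccEquiv'_symm_some]

/-- Reading a vector through `reix p` is inserting its last coordinate at `p`. [folklore] -/
theorem comp_reix_eq_insertNth (p : Fin (k + 1)) (w : Fin (k + 1) → ℝ) :
    (fun i => w (reix p i)) = Fin.insertNth p (w (Fin.last k)) (Fin.init w) := by
  ext i
  rcases Fin.eq_self_or_eq_succAbove p i with rfl | ⟨j, rfl⟩
  · simp
  · simp [Fin.init]

/-! ### The entry pieces of the dissection -/

/-- The entry piece `D_p = {x ∈ (0,1)ᵏ⁺¹ | x_l < x_p for every other −1-coordinate l}` of the
torus orbit through the face `x_p = 1`. -/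
def piece (lam : Fin (k + 1) → ℤ) (p : Fin (k + 1)) : Set (Fin (k + 1) → ℝ) :=
  {x | (∀ i, x i ∈ Ioo (0:ℝ) 1) ∧ ∀ l, l ≠ p → lam l = -1 → x l < x p}

/-- The entry pieces are `ℚ`-semialgebraic. [cite: BochnakCosteRoy1998, §2.1] -/
theorem isSemialgebraic_piece (lam : Fin (k + 1) → ℤ) (p : Fin (k + 1)) :
    IsSemialgebraic ℚ (piece lam p) := by
  classical
  have h : piece lam p = openUnitCube (k + 1) ∩
      ⋂ l ∈ Finset.univ.filter (fun l : Fin (k + 1) => l ≠ p ∧ lam l = -1),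
        {x : Fin (k + 1) → ℝ | x l < x p} := by
    ext x
    simp [piece, openUnitCube]
  rw [h]
  refine isSemialgebraic_openUnitCube.inter (IsSemialgebraic.biInter _ _ fun l _ => ?_)
  simpa using isSemialgebraic_setOf_eval_lt (k := ℚ) (R := ℝ)
    (X l : MvPolynomial (Fin (k + 1)) ℚ) (X p)

/-- The entry pieces lie in the open cube. [folklore] -/
theorem piece_subset_openUnitCube (lam : Fin (k + 1) → ℤ) (p : Fin (k + 1)) :
    piece lam p ⊆ openUnitCube (k + 1) := fun _ hx => hx.1

/-- **Reindexed, the entry piece `D_p` is the wedge of `μ = lam ∘ p.succAbove`.** [folklore] -/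
theorem setOf_comp_reix_mem_piece (lam : Fin (k + 1) → ℤ) (p : Fin (k + 1)) :
    {w : Fin (k + 1) → ℝ | (fun i => w (reix p i)) ∈ piece lam p} =
      wedge (fun j => lam (p.succAbove j)) := by
  ext w
  simp only [mem_setOf_eq, piece, wedge, comp_reix_eq_insertNth]
  rw [Fin.forall_iff_succAbove p, Fin.forall_iff_succAbove p, Fin.forall_fin_succ']
  simp only [Fin.insertNth_apply_same, Fin.insertNth_apply_succAbove, ne_eq, not_true_eq_false,
    false_implies, true_and, Fin.init]
  constructor
  · rintro ⟨⟨hl, hc⟩, h⟩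
    exact ⟨⟨hc, hl⟩, fun j hj => h j (Fin.succAbove_ne p j) hj⟩
  · rintro ⟨⟨hc, hl⟩, h⟩
    exact ⟨⟨hl, hc⟩, fun j _ hj => h j hj⟩


/-! ### The data of one descent -/

/-- The data and hypotheses of one torus descent: an atom `[□ᵏ⁺¹, q · atomFun a e]` (the
representation `s`), a simple descent direction `lam ∈ {0, ±1}ᵏ⁺¹` orthogonal to the active chords
and of non-zero total weight, and an entry face `p` (`lam p = −1`). -/
structure Descent (k : ℕ) where
  /-- the rational constant -/
  q : ℚ
  /-- the monomial exponents -/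
  a : Fin (k + 1) → ℕ
  /-- the chord exponents -/
  e : Fin (k + 1) → Fin (k + 1) → ℤ
  /-- the descent direction -/
  lam : Fin (k + 1) → ℤ
  /-- the entry face -/
  p : Fin (k + 1)
  /-- the atom, as an integral representation -/
  s : KZ.IntegralRep (k + 1)
  /-- its domain is the open cube -/
  hdom : s.domain = openUnitCube (k + 1)
  /-- its integrand is the atom integrand -/
  hint : EqOn s.integrand (fun x => (q : ℝ) * atomFun a e x) s.domain
  /-- the direction is `{0, ±1}`-valued -/
  hlam : ∀ l, lam l = 0 ∨ lam l = 1 ∨ lam l = -1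
  /-- `p` is an entry face -/
  hp : lam p = -1
  /-- the direction is orthogonal to every active chord -/
  hch : ∀ i j : Fin (k + 1), i ≤ j → e i j ≠ 0 →
    (∑ l : Fin (k + 1), if i ≤ l ∧ l ≤ j then lam l else 0) = 0
  /-- the total weight is non-zero -/
  hE : wt a lam ≠ 0

namespace Descent

variable (D : Descent k)

/-- The direction read off the entry face: `μ_j = lam (p.succAbove j)`. -/
def dir : Fin k → ℤ := fun j => D.lam (D.p.succAbove j)

/-- `μ` is `{0, ±1}`-valued. [folklore] -/
theorem dir_mem_signs : ∀ j, D.dir j = 0 ∨ D.dir j = 1 ∨ D.dir j = -1 := fun j =>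
  D.hlam (D.p.succAbove j)

/-- The integrand `q · g₀(insertNth p 1 y) · s^{−E−1}` on the straightened band. -/
def bandFun (z : Fin (k + 1) → ℝ) : ℝ :=
  (D.q : ℝ) * atomFun D.a D.e (Fin.insertNth D.p 1 (Fin.init z)) * z (Fin.last k) ^ (-(wt D.a D.lam) - 1)

/-- Its fibrewise monomial primitive `−(q/E) · g₀(insertNth p 1 y) · s^{−E}`. -/
def primFun (z : Fin (k + 1) → ℝ) : ℝ :=
  -((((D.q / ((wt D.a D.lam : ℤ) : ℚ) : ℚ) : ℝ)) * atomFun D.a D.e (Fin.insertNth D.p 1 (Fin.init z)) *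
    z (Fin.last k) ^ (-(wt D.a D.lam)))

/-- The closed band `{(y, s) | y ∈ (0,1)ᵏ, M_p(y) ≤ s ≤ 1}` of the Newton–Leibniz move. -/
def closedBand : Set (Fin (k + 1) → ℝ) := KZlog.band (openUnitCube k) (topP D.lam D.p) fun _ => 1

/-! ### Semialgebraicity -/

/-- The `+1`-coordinates are positive on the open cube. [folklore] -/
theorem pos_of_mem_openUnitCube : ∀ y ∈ openUnitCube k, ∀ j : Fin k,
    D.lam (Fin.succAbove D.p j) = 1 → 0 < y j := fun _ hy j _ => (hy j).1

/-- The band integrand is `ℚ`-semialgebraic on every `ℚ`-semialgebraic set. [folklore] -/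
theorem isSemialgebraicFunOn_bandFun {S : Set (Fin (k + 1) → ℝ)} (hS : IsSemialgebraic ℚ S) :
    IsSemialgebraicFunOn ℚ S D.bandFun := by
  have hq : IsSemialgebraicFunOn ℚ S fun _ => (D.q : ℝ) := isSemialgebraicFunOn_const_ratCast hS D.q
  have h1 : IsSemialgebraicFunOn ℚ S fun _ : Fin (k + 1) → ℝ => (1 : ℝ) := by
    simpa using isSemialgebraicFunOn_const_ratCast hS 1
  have hA := isSemialgebraicFunOn_atomFun_comp hS D.a D.e
    (X := fun z : Fin (k + 1) → ℝ => (Fin.insertNth D.p (1:ℝ) (Fin.init z) : Fin (k + 1) → ℝ))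
    fun i => isSemialgebraicFunOn_insertNth h1 (fun j => isSemialgebraicFunOn_apply hS _) D.p i
  exact (hq.fun_mul hA).fun_mul (fun_zpow (isSemialgebraicFunOn_apply hS (Fin.last k)) _)

/-- The primitive is `ℚ`-semialgebraic on every `ℚ`-semialgebraic set. [folklore] -/
theorem isSemialgebraicFunOn_primFun {S : Set (Fin (k + 1) → ℝ)} (hS : IsSemialgebraic ℚ S) :
    IsSemialgebraicFunOn ℚ S D.primFun := by
  have hq : IsSemialgebraicFunOn ℚ S fun _ => (((D.q / ((wt D.a D.lam : ℤ) : ℚ) : ℚ) : ℝ)) :=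
    isSemialgebraicFunOn_const_ratCast hS _
  have h1 : IsSemialgebraicFunOn ℚ S fun _ : Fin (k + 1) → ℝ => (1 : ℝ) := by
    simpa using isSemialgebraicFunOn_const_ratCast hS 1
  have hA := isSemialgebraicFunOn_atomFun_comp hS D.a D.e
    (X := fun z : Fin (k + 1) → ℝ => (Fin.insertNth D.p (1:ℝ) (Fin.init z) : Fin (k + 1) → ℝ))
    fun i => isSemialgebraicFunOn_insertNth h1 (fun j => isSemialgebraicFunOn_apply hS _) D.p i
  exact ((hq.fun_mul hA).fun_mul (fun_zpow (isSemialgebraicFunOn_apply hS (Fin.last k)) _)).fun_neg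

/-- The base integrand is `ℚ`-semialgebraic on the open cube. [folklore] -/
theorem isSemialgebraicFunOn_baseFun :
    IsSemialgebraicFunOn ℚ (openUnitCube k) (baseFun D.q D.a D.e D.lam D.p) := by
  have hS : IsSemialgebraic ℚ (openUnitCube k) := isSemialgebraic_openUnitCube
  have hq : IsSemialgebraicFunOn ℚ (openUnitCube k)
      fun _ => (((D.q / ((wt D.a D.lam : ℤ) : ℚ) : ℚ) : ℝ)) := isSemialgebraicFunOn_const_ratCast hS _
  have h1 : IsSemialgebraicFunOn ℚ (openUnitCube k) fun _ : Fin k → ℝ => (1 : ℝ) := by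
    simpa using isSemialgebraicFunOn_const_ratCast hS 1
  have hA := isSemialgebraicFunOn_atomFun_comp hS D.a D.e
    (X := fun y : Fin k → ℝ => (Fin.insertNth D.p (1:ℝ) y : Fin (k + 1) → ℝ))
    fun i => isSemialgebraicFunOn_insertNth h1 (fun j => isSemialgebraicFunOn_apply hS j) D.p i
  have hM := (fun_zpow (isSemialgebraicFunOn_topP D.lam D.p hS D.pos_of_mem_openUnitCube)
    (-(wt D.a D.lam))).fun_sub h1
  exact (hq.fun_mul hA).fun_mul hM

/-- The constant `1` is `ℚ`-semialgebraic on the open cube. [folklore] -/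
theorem isSemialgebraicFunOn_one_openUnitCube :
    IsSemialgebraicFunOn ℚ (openUnitCube k) fun _ : Fin k → ℝ => (1 : ℝ) := by
  simpa using isSemialgebraicFunOn_const_ratCast (isSemialgebraic_openUnitCube (d := k)) 1

/-- The closed band is `ℚ`-semialgebraic. [folklore] -/
theorem isSemialgebraic_closedBand : IsSemialgebraic ℚ D.closedBand :=
  KZlog.isSemialgebraic_band
    (isSemialgebraicFunOn_topP D.lam D.p isSemialgebraic_openUnitCube D.pos_of_mem_openUnitCube)
    isSemialgebraicFunOn_one_openUnitCube

/-- The closed band is measurable. [folklore] -/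
theorem measurableSet_closedBand : MeasurableSet D.closedBand :=
  IsSemialgebraic.measurableSet_holds D.isSemialgebraic_closedBand

/-! ### The fibres -/

/-- `M_p(y) < 1` on the open cube. [folklore] -/
theorem topP_lt_one {y : Fin k → ℝ} (hy : y ∈ openUnitCube k) : topP D.lam D.p y < 1 :=
  (topP_lt_iff D.lam D.p y (fun j _ => (hy j).1.le) 1).2 ⟨one_pos, fun j _ => (hy j).2⟩

/-- `0 ≤ M_p(y)` on the open cube. [folklore] -/
theorem topP_nonneg_of_mem {y : Fin k → ℝ} (hy : y ∈ openUnitCube k) : 0 ≤ topP D.lam D.p y :=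
  topP_nonneg D.lam D.p y fun j _ => (hy j).1.le

/-- **The fibre dichotomy**: either the fibre `[M_p(y), 1]` stays away from `0`, or there is no
`+1`-coordinate and the weight `E` is negative (so all powers of `s` involved are monomials).
[folklore] -/
theorem topP_pos_or_wt_neg {y : Fin k → ℝ} (hy : y ∈ openUnitCube k) :
    0 < topP D.lam D.p y ∨ wt D.a D.lam < 0 := by
  by_cases h : ∃ j, D.lam (D.p.succAbove j) = 1
  · obtain ⟨j, hj⟩ := h
    exact Or.inl ((hy j).1.trans_le (le_topP D.lam D.p y hj))
  · push Not at h
    right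
    unfold wt
    rw [Fin.sum_univ_succAbove _ D.p, D.hp]
    have hle : ∀ j, D.lam (D.p.succAbove j) * ((D.a (D.p.succAbove j) : ℤ) + 1) ≤ 0 := fun j => by
      rcases D.hlam (D.p.succAbove j) with h0 | h1 | hm
      · simp [h0]
      · exact absurd h1 (h j)
      · rw [hm]; omega
    have hsum := Finset.sum_nonpos fun j (_ : j ∈ (Finset.univ : Finset (Fin k))) => hle j
    have hp0 : (-1 : ℤ) * ((D.a D.p : ℤ) + 1) < 0 := by omega
    linarith

/-- The band integrand on a fibre. [folklore] -/
theorem bandFun_snoc (y : Fin k → ℝ) (t : ℝ) : D.bandFun (Fin.snoc y t) =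
    (D.q : ℝ) * atomFun D.a D.e (Fin.insertNth D.p 1 y) * t ^ (-(wt D.a D.lam) - 1) := by
  simp [bandFun]

/-- The primitive on a fibre. [folklore] -/
theorem primFun_snoc (y : Fin k → ℝ) (t : ℝ) : D.primFun (Fin.snoc y t) =
    -((((D.q / ((wt D.a D.lam : ℤ) : ℚ) : ℚ) : ℝ)) * atomFun D.a D.e (Fin.insertNth D.p 1 y) *
      t ^ (-(wt D.a D.lam))) := by
  simp [primFun]

/-- **`∂_s primFun = bandFun`** off `s = 0`. [folklore] -/
theorem hasDerivAt_primFun (y : Fin k → ℝ) {t : ℝ} (ht : t ≠ 0) :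
    HasDerivAt (fun u : ℝ => D.primFun (Fin.snoc y u)) (D.bandFun (Fin.snoc y t)) t := by
  have hE : ((wt D.a D.lam : ℤ) : ℝ) ≠ 0 := by exact_mod_cast D.hE
  set c : ℝ := (((D.q / ((wt D.a D.lam : ℤ) : ℚ) : ℚ) : ℝ)) * atomFun D.a D.e (Fin.insertNth D.p 1 y)
    with hc
  have hfun : (fun u : ℝ => D.primFun (Fin.snoc y u)) = fun u => -(c * u ^ (-(wt D.a D.lam))) :=
    funext fun u => by rw [primFun_snoc]
  rw [hfun, bandFun_snoc]
  refine HasDerivAt.congr_deriv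
    (((hasDerivAt_zpow (-(wt D.a D.lam)) t (Or.inl ht)).const_mul c).neg) ?_
  rw [hc]
  push_cast
  field_simp

/-- The primitive is continuous on the closed fibre. [folklore] -/
theorem continuousOn_primFun_snoc (y : Fin k → ℝ) {u v : ℝ} (h : 0 < u ∨ wt D.a D.lam < 0) :
    ContinuousOn (fun t : ℝ => D.primFun (Fin.snoc y t)) (Icc u v) := by
  simp only [primFun_snoc]
  exact (continuousOn_const.mul
    (continuousOn_zpow_Icc (-(wt D.a D.lam)) (h.imp id fun h' => by omega))).neg

/-- The band integrand is continuous on the closed fibre. [folklore] -/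
theorem continuousOn_bandFun_snoc (y : Fin k → ℝ) {u v : ℝ} (h : 0 < u ∨ wt D.a D.lam < 0) :
    ContinuousOn (fun t : ℝ => D.bandFun (Fin.snoc y t)) (Icc u v) := by
  simp only [bandFun_snoc]
  exact continuousOn_const.mul
    (continuousOn_zpow_Icc (-(wt D.a D.lam) - 1) (h.imp id fun h' => by omega))

/-- **The base integrand is the fibrewise Newton–Leibniz difference** `F(y,1) − F(y,M_p(y))`
(including the degenerate fibre `M_p(y) = 0`, where `E < 0` and `0^{−E} = 0`). [folklore] -/
theorem baseFun_eq (y : Fin k → ℝ) : baseFun D.q D.a D.e D.lam D.p y =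
    D.primFun (Fin.snoc y 1) - D.primFun (Fin.snoc y (topP D.lam D.p y)) := by
  simp only [baseFun, primFun_snoc, one_zpow]
  ring

/-- **Fibrewise triangle inequality**: `‖base y‖ₑ ≤ ∫⁻_{[M_p(y),1]} ‖bandFun (y,s)‖ₑ ds`.
[folklore] -/
theorem enorm_baseFun_le {y : Fin k → ℝ} (hy : y ∈ openUnitCube k) :
    ‖baseFun D.q D.a D.e D.lam D.p y‖ₑ ≤
      ∫⁻ t in Icc (topP D.lam D.p y) 1, ‖D.bandFun (Fin.snoc y t)‖ₑ := by
  rw [baseFun_eq]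
  have h := D.topP_pos_or_wt_neg hy
  exact enorm_sub_le_lintegral_Icc (F := fun t => D.primFun (Fin.snoc y t)) (D.topP_lt_one hy).le
    (D.continuousOn_primFun_snoc y h)
    (fun t ht => D.hasDerivAt_primFun y ((D.topP_nonneg_of_mem hy).trans_lt ht.1).ne')
    (D.continuousOn_bandFun_snoc y h)

/-! ### The open band, the closed band, and the transport of integrability -/

/-- The open band `wedge (−μ)` lies in the closed band. [folklore] -/
theorem wedge_subset_closedBand : wedge (-D.dir) ⊆ D.closedBand := by
  intro z hz
  have hcube : Fin.init z ∈ openUnitCube k := fun j => hz.1 (Fin.castSucc j)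
  refine ⟨hcube, ?_, (hz.1 (Fin.last k)).2.le⟩
  refine topP_le D.lam D.p _ (hz.1 (Fin.last k)).1.le fun j hj => (hz.2 j ?_).le
  simp [dir, hj]

/-- The closed band exceeds the open band by the top lid and the graph of `M_p`. [folklore] -/
theorem closedBand_diff_subset : D.closedBand \ wedge (-D.dir) ⊆
    {z | z (Fin.last k) = 1} ∪
      {z | Fin.init z ∈ openUnitCube k ∧ z (Fin.last k) = topP D.lam D.p (Fin.init z)} := by
  rintro z ⟨⟨hcube, hlo, hhi⟩, hz⟩
  by_contra hcon
  simp only [mem_union, mem_setOf_eq, not_or, not_and] at hcon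
  have h1 : z (Fin.last k) < 1 := lt_of_le_of_ne hhi hcon.1
  have h2 : topP D.lam D.p (Fin.init z) < z (Fin.last k) := lt_of_le_of_ne hlo (Ne.symm (hcon.2 hcube))
  have h0 : 0 < z (Fin.last k) := (D.topP_nonneg_of_mem hcube).trans_lt h2
  refine hz ⟨fun i => ?_, fun j hj => ?_⟩
  · refine Fin.lastCases ⟨h0, h1⟩ (fun j => hcube j) i
  · have hj' : D.lam (D.p.succAbove j) = 1 := by simp [dir] at hj; omega
    exact (le_topP D.lam D.p (Fin.init z) hj').trans_lt h2

/-- The two bands differ by a null set. [folklore] -/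
theorem volume_closedBand_diff : volume (D.closedBand \ wedge (-D.dir)) = 0 :=
  measure_mono_null D.closedBand_diff_subset (measure_union_null (KZ.volume_setOf_last_eq_zero 1)
    (KZ.volume_graph_eq_zero
      (isSemialgebraicFunOn_topP D.lam D.p isSemialgebraic_openUnitCube D.pos_of_mem_openUnitCube)))

/-- The open band lies in the closed one. [folklore] -/
theorem volume_wedge_diff : volume (wedge (-D.dir) \ D.closedBand) = 0 :=
  measure_mono_null (fun _ hz => (hz.2 (D.wedge_subset_closedBand hz.1)).elim)
    (measure_empty (μ := volume))

end Descent


/-- Registered sub-goal `stub_torusDescentAux3` of `stub_torusDescent` (the fibre dichotomy: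
either the straightened band stays away from `s = 0` or the total weight is negative). [folklore] -/
theorem stub_torusDescentAux3 : ∀ (k : ℕ) (a : Fin (k + 1) → ℕ) (lam : Fin (k + 1) → ℤ) (p : Fin (k + 1)) (y : Fin k → ℝ), (∀ l : Fin (k + 1), lam l = 0 ∨ lam l = 1 ∨ lam l = -1) → lam p = -1 → (∀ i, y i ∈ Set.Ioo (0:ℝ) 1) → 0 < (⨆ j : Fin k, if lam (Fin.succAbove p j) = 1 then y j else (0:ℝ)) ∨ (∑ l : Fin (k + 1), lam l * ((a l : ℤ) + 1)) < 0 := by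
  intro k a lam p y hlam hp hy
  by_cases h : ∃ j, lam (p.succAbove j) = 1
  · obtain ⟨j, hj⟩ := h
    exact Or.inl ((hy j).1.trans_le (le_topP lam p y hj))
  · push Not at h
    right
    rw [Fin.sum_univ_succAbove _ p, hp]
    have hle : ∀ j, lam (p.succAbove j) * ((a (p.succAbove j) : ℤ) + 1) ≤ 0 := fun j => by
      rcases hlam (p.succAbove j) with h0 | h1 | hm
      · simp [h0]
      · exact absurd h1 (h j)
      · rw [hm]; omega
    have hsum := Finset.sum_nonpos fun j (_ : j ∈ (Finset.univ : Finset (Fin k))) => hle j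
    have hp0 : (-1 : ℤ) * ((a p : ℤ) + 1) < 0 := by omega
    linarith

end Summit.KontsevichZagierPeriods.DihedralNormalForm.TorusDescent
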